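/-
Copyright: harness tree, Literature layer (sorry-free). b2b-lace carver-g43 (CARVER gen 43), D10-KERNEL census v7,
node KU-SEP, leaf KU-SEP-GLUE: composition of the kernel-decided instance `TrigEncl.MajCert.gset_sound`
(`SrwTrigMajorantKernel`, Part B) with the cell-check soundness lemma `abs_le_of_cellCheck`
(`SrwTrigMajorantCells`) and the majorant reduction `srwK_le_of_trigMajorant` / `srwU_le_of_trigMajorant`
(`SrwTrigMajorant`).  What-if / input-certification lane.  DRAFT — UNCHECKED (the farm snapshot does not yet
contain the three imported modules; check + file after the rebuild).
-/
import Literature.Probability.FitznerVanDerHofstad2017.SrwTrigMajorant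
import Literature.Probability.FitznerVanDerHofstad2017.SrwTrigMajorantCells
import Literature.Probability.FitznerVanDerHofstad2017.SrwTrigMajorantKernel
import HarnessLib

/-!
# The global K/U separable majorant: `|t| ≤ g(t)` on `[-1,1]` and the resulting `K`/`U` bounds (what-if lane)

`g(t) = B + c t² + Σ_{r<6} a_r cos(b_r t)` with the literal rationals of `TrigEncl.MajCert.gset`.  From the
kernel-decided cell facts `gset_sound` and `abs_le_of_cellCheck` we get `hmaj : ∀ t ∈ [-1,1], |t| ≤ g(t)`, and
from `srwK_le_of_trigMajorant` / `srwU_le_of_trigMajorant` the generic-`d` bounds of `K_{n,l}(x; d)`, `U_{n,l}(x; d)`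
(`d ≥ 2n+1`) by the three families of SEEDCERT-class objects `srwTwist`, `srwSqMom`.  Nothing here is a value
of a lace-expansion quantity; no dimension is fixed.
[cite: FitznerVanDerHofstad2016NoBLE, §5.1.2 (5.11)–(5.16) pp. 1091–1092]
-/

set_option Elab.async false

namespace Literature.Probability.FitznerVanDerHofstad2017

open TrigEncl MeasureTheory
open Literature.Barriers.CriticalPhenomena

variable {d : ℕ}

/-- The cosine coefficients of the global set, as reals over `Fin 6`.
[cite: FitznerVanDerHofstad2016NoBLE, §5.1.2 (5.11) p. 1091] -/
noncomputable def gsetA : Fin 6 → ℝ := fun r => (MajCert.gset.a r : ℝ)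

/-- The cosine frequencies of the global set, as reals over `Fin 6`.
[cite: FitznerVanDerHofstad2016NoBLE, §5.1.2 (5.11) p. 1091] -/
noncomputable def gsetB : Fin 6 → ℝ := fun r => (MajCert.gset.b r : ℝ)

/-- The global set has six cosine terms. [folklore] -/
private theorem gset_R : MajCert.gset.R = 6 := rfl

/-- The global set has `N = 250` cells. [folklore] -/
private theorem gset_N : MajCert.gset.N = 250 := rfl

/-- `trigMaj` of the global set is the kernel's `MajCert.gset.g`. [folklore] -/
private theorem trigMaj_gset (y : ℝ) :
    trigMaj (MajCert.gset.B : ℝ) (MajCert.gset.c : ℝ) gsetA gsetB y = MajCert.gset.g y := by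
  simp only [trigMaj, MajCert.g, gset_R, gsetA, gsetB]
  rw [← Fin.sum_univ_eq_sum_range (fun r => (MajCert.gset.a r : ℝ) * Real.cos ((MajCert.gset.b r : ℝ) * y)) 6]

/-- `trigMajDeriv` of the global set is the kernel's `MajCert.gset.g'`. [folklore] -/
private theorem trigMajDeriv_gset (y : ℝ) :
    trigMajDeriv (MajCert.gset.c : ℝ) gsetA gsetB y = MajCert.gset.g' y := by
  simp only [trigMajDeriv, MajCert.g', gset_R, gsetA, gsetB]
  rw [← Fin.sum_univ_eq_sum_range
    (fun r => (MajCert.gset.a r : ℝ) * (MajCert.gset.b r : ℝ) * Real.sin ((MajCert.gset.b r : ℝ) * y)) 6]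

/-- `trigMajM2` of the global set is the cast of the kernel's `MajCert.gset.M2`. [folklore] -/
private theorem trigMajM2_gset :
    trigMajM2 (MajCert.gset.c : ℝ) gsetA gsetB = (MajCert.gset.M2 : ℝ) := by
  simp only [trigMajM2, MajCert.M2, gset_R, gsetA, gsetB]
  push_cast
  rw [← Fin.sum_univ_eq_sum_range (fun r => |(MajCert.gset.a r : ℝ)| * (MajCert.gset.b r : ℝ) ^ 2) 6]

/-- The kernel's cell centre `x_i = (2i+1)/(2N)` as a real, `N = 250`. [folklore] -/
private theorem x_gset (i : ℕ) :
    ((MajCert.gset.x i : ℚ) : ℝ) = (2 * (i : ℝ) + 1) / (2 * ((250 : ℕ) : ℝ)) := by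
  simp only [MajCert.x, MajCert.h, gset_N]
  push_cast
  ring

/-- The kernel's half cell width `h = 1/(2N)` as a real, `N = 250`. [folklore] -/
private theorem h_gset : ((MajCert.gset.h : ℚ) : ℝ) = 1 / (2 * ((250 : ℕ) : ℝ)) := by
  simp only [MajCert.h, gset_N]
  push_cast
  ring

/-- **The global separable majorant of `|t|`**: for every `t ∈ [-1,1]`,
`|t| ≤ B + c t² + Σ_{r<6} a_r cos(b_r t)` with the literal coefficients of `TrigEncl.MajCert.gset`
(kernel-decided cell check `gset_check` + `abs_le_of_cellCheck`).
[cite: FitznerVanDerHofstad2016NoBLE, §5.1.2 (5.11)–(5.16) pp. 1091–1092] -/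
theorem abs_le_trigMaj_gset : ∀ t ∈ Set.Icc (-1 : ℝ) 1,
    |t| ≤ (MajCert.gset.B : ℝ) + (MajCert.gset.c : ℝ) * t ^ 2 + ∑ r, gsetA r * Real.cos (gsetB r * t) := by
  obtain ⟨_, hM, hg, hd, hcell⟩ := MajCert.gset_sound
  refine abs_le_of_cellCheck (MajCert.gset.B : ℝ) (MajCert.gset.c : ℝ) gsetA gsetB (N := 250) (by norm_num)
    (fun i => (MajCert.gset.gLo i : ℝ)) (fun i => (MajCert.gset.dAbs i : ℝ)) (MajCert.gset.M2up : ℝ)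
    ?_ ?_ ?_ ?_
  · intro i
    rw [trigMaj_gset, ← x_gset]
    exact hg i
  · intro i
    rw [trigMajDeriv_gset, ← x_gset]
    exact hd i
  · rw [trigMajM2_gset]; exact hM
  · intro i
    have := hcell i
    rw [x_gset, h_gset] at this
    exact this

/-- **`K_{n,l}(x; d)` by the global separable majorant** (`d ≥ 2n+1`, any `l`, any `x`):
`K_{n,l}(x) ≤ B·Tw_n(x; 0) + c·Sq_n(x) + Σ_r a_r·Tw_n(x; b_r)` with the weight `|D̂|^l` and the literal
coefficients of `gset`.
[cite: FitznerVanDerHofstad2016NoBLE, (5.9) p. 1092; §5.1.2 (5.11)–(5.16) pp. 1091–1092] -/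
theorem srwK_le_gset {n : ℕ} (hd : 2 * n + 1 ≤ d) (l : ℕ) (x : Fin d → ℤ) :
    srwK d n l x ≤ (MajCert.gset.B : ℝ) * srwTwist d n (fun k => |Dhat d k| ^ l) x 0
      + (MajCert.gset.c : ℝ) * srwSqMom d n (fun k => |Dhat d k| ^ l) x
      + ∑ r, gsetA r * srwTwist d n (fun k => |Dhat d k| ^ l) x (gsetB r) :=
  srwK_le_of_trigMajorant hd l x _ _ gsetA gsetB abs_le_trigMaj_gset

/-- **`U_{n,l}(x; d)` by the global separable majorant** (`d ≥ 2n+1`, any `l`, any `x`): the same bound with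
the weight `|D̂|^l D̂^{sin}`.  [cite: FitznerVanDerHofstad2016NoBLE, (3.38) p. 1071; (5.9) p. 1092] -/
theorem srwU_le_gset {n : ℕ} (hd : 2 * n + 1 ≤ d) (l : ℕ) (x : Fin d → ℤ) :
    srwU d n l x ≤ (MajCert.gset.B : ℝ) * srwTwist d n (fun k => |Dhat d k| ^ l * Dsin d k) x 0
      + (MajCert.gset.c : ℝ) * srwSqMom d n (fun k => |Dhat d k| ^ l * Dsin d k) x
      + ∑ r, gsetA r * srwTwist d n (fun k => |Dhat d k| ^ l * Dsin d k) x (gsetB r) :=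
  srwU_le_of_trigMajorant hd l x _ _ gsetA gsetB abs_le_trigMaj_gset

end Literature.Probability.FitznerVanDerHofstad2017
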